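import Summits.HubbardSuperconductivity.HubbardSuperconductivity.Theorems.FunctionFieldCertificateMesoscopicPairOrderNecessity
import HarnessLib

/-!
# Crux `MesoscopicPairOrder` (stmt-HubbardSuperconductivity-7331) — block sums of the Fejér-box functional at two scales

Support file 1 of 2 for the SCALE LADDER of the crux functional (route `FunctionFieldCertificate`,
pole-free half; line `Sketch`, lead c1). The crux asks, at one `(U, δ)`, for a margin `m R²` of
the Fejér-box `d`-wave pair functional
`T_R(ψ) = Σ_{x,y} Πᵢ (1 - |(y - x)ᵢ|_L/R)₊ Re⟨P_x ψ, P_y ψ⟩` in every normalised sector ground state,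
for ARBITRARILY LARGE scales `R`. By the tent identity
(`FunctionFieldCertificateAssembly.re_sum_star_blockMulVec_dotProduct_eq`) `R² T_R(ψ) = Σ_a ‖B_R(a)ψ‖²`
with the blocks `B_R(a) = Σ_{u ∈ [0,R)²} P_{a+u}`; this file compares the block sums at two scales,
model-free (any family of matrices `P_x` on `(ℤ/Lℤ)²`, any vector `ψ`):

* `sum_offset_mul_eq`, `block_mul_eq_sum_block` — the block of side `qR'` is the sum of the `q²`
  blocks of side `R'` anchored on the sub-lattice `a + R'·[0,q)²` (offset arithmetic
  `u = R'·b + u'`, `finProdFinEquiv` coordinatewise);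
* `sum_block_mul_le` — hence `Σ_a ‖B_{qR'}(a)ψ‖² ≤ q⁴ Σ_a ‖B_{R'}(a)ψ‖²` (Cauchy–Schwarz over the
  `q²` sub-blocks, translation invariance of the anchor sum);
* `re_star_add_dotProduct_add_le` — `‖X + Y‖² ≤ 2‖X‖² + 2‖Y‖²`;
* `sum_block_le_of_mul_le` — for a general `R ≥ qR'` the same with the remainder frame
  `[0,R)² ∖ [0,qR')²` paid by the local weight:
  `Σ_a ‖B_R(a)ψ‖² ≤ 2q⁴ Σ_a ‖B_{R'}(a)ψ‖² + 2 (R² - q²R'²)² Σ_x ‖P_x ψ‖²`.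

File 2 (`…ScaleLadder.lean`) turns these into the monotonicity / transfer inequalities for `T_R`
and the every-scale form of the crux. Sources: Stein–Shakarchi, *Fourier Analysis*, Ch. 2–3
(Fejér kernel as the autocorrelation of a box); Kennedy–Lieb–Shastry, PRL 61 (1988) 2582 (block
bookkeeping). Folklore; no definition is introduced (blocks written inline, verbatim as in
`fejerBox_floor`).
-/

noncomputable section

-- the summit namespace `Summit.HubbardSuperconductivity.HubbardSuperconductivity.…` repeats the problem name by design (D-0017)
set_option linter.dupNamespace false

namespace Summit.HubbardSuperconductivity.HubbardSuperconductivity.Theorems.FunctionFieldCertificate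

open Matrix Finset Filter
open Literature.Probability.LatticeModels Literature.MathematicalPhysics.QuantumLattice
open scoped ComplexOrder

/-! ### Offset arithmetic: a block of side `qR'` is `q²` blocks of side `R'` -/

section Offsets

variable {L : ℕ} {M : Type*} [AddCommMonoid M]

/-- **Offset decomposition.** Summing over the offsets `u ∈ [0, qR')²` is summing over the
sub-block index `b ∈ [0,q)²` and the sub-offset `u' ∈ [0,R')²` of `u = R'·b + u'`
(`finProdFinEquiv`, coordinatewise). [folklore] -/
theorem sum_offset_mul_eq (q R' : ℕ) (f : TorusSite 2 L → M) :
    ∑ u : Fin 2 → Fin (q * R'), f (fun i => ((u i : ℕ) : ZMod L)) =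
      ∑ b : Fin 2 → Fin q, ∑ u' : Fin 2 → Fin R',
        f ((fun i => ((R' * (b i : ℕ) : ℕ) : ZMod L)) + fun i => ((u' i : ℕ) : ZMod L)) := by
  rw [← Fintype.sum_prod_type']
  refine Fintype.sum_equiv ((Equiv.piCongrRight fun _ : Fin 2 => finProdFinEquiv.symm).trans
    (Equiv.arrowProdEquivProdArrow (Fin 2) (fun _ => Fin q) (fun _ => Fin R'))) _ _ fun u => ?_
  congr 1
  funext i
  simp only [Equiv.trans_apply, Equiv.piCongrRight_apply, Pi.map_apply,
    Equiv.arrowProdEquivProdArrow_apply, finProdFinEquiv_symm_apply, Fin.coe_divNat,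
    Fin.coe_modNat, Pi.add_apply]
  rw [← Nat.cast_add, Nat.div_add_mod]

end Offsets

/-! ### Block sums at two scales -/

section Blocks

variable {n : Type*} [Fintype n] {L : ℕ} [NeZero L]

omit [Fintype n] [NeZero L] in
/-- **The block of side `qR'` anchored at `a` is the sum of the `q²` blocks of side `R'` anchored
at `a + R'·b`, `b ∈ [0,q)²`** (any family of matrices on the torus). [folklore] -/
theorem block_mul_eq_sum_block (q R' : ℕ) (P : TorusSite 2 L → Matrix n n ℂ) (a : TorusSite 2 L) :
    ∑ u : Fin 2 → Fin (q * R'), P (a + fun i => ((u i : ℕ) : ZMod L)) =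
      ∑ b : Fin 2 → Fin q, ∑ u' : Fin 2 → Fin R',
        P ((a + fun i => ((R' * (b i : ℕ) : ℕ) : ZMod L)) + fun i => ((u' i : ℕ) : ZMod L)) := by
  rw [sum_offset_mul_eq q R' (fun z => P (a + z))]
  simp only [add_assoc]

/-- **Coarse blocks are controlled by fine blocks**: for any family of matrices `P_x` on
`(ℤ/Lℤ)²`, any vector `ψ` and blocks `B_R(a) = Σ_{u ∈ [0,R)²} P_{a+u}`,
`Σ_a ‖B_{qR'}(a) ψ‖² ≤ q⁴ · Σ_a ‖B_{R'}(a) ψ‖²` — Cauchy–Schwarz over the `q²` sub-blocks of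
`block_mul_eq_sum_block`, then translation invariance of the anchor sum. [folklore] -/
theorem sum_block_mul_le (q R' : ℕ) (P : TorusSite 2 L → Matrix n n ℂ) (ψ : n → ℂ) :
    ∑ a : TorusSite 2 L,
        (star ((∑ u : Fin 2 → Fin (q * R'), P (a + fun i => ((u i : ℕ) : ZMod L))) *ᵥ ψ) ⬝ᵥ
          ((∑ u : Fin 2 → Fin (q * R'), P (a + fun i => ((u i : ℕ) : ZMod L))) *ᵥ ψ)).re ≤
      (q : ℝ) ^ 4 * ∑ a : TorusSite 2 L,
        (star ((∑ u : Fin 2 → Fin R', P (a + fun i => ((u i : ℕ) : ZMod L))) *ᵥ ψ) ⬝ᵥ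
          ((∑ u : Fin 2 → Fin R', P (a + fun i => ((u i : ℕ) : ZMod L))) *ᵥ ψ)).re := by
  -- fine blocks as a function of the anchor
  set F : TorusSite 2 L → ℝ := fun a =>
    (star ((∑ u : Fin 2 → Fin R', P (a + fun i => ((u i : ℕ) : ZMod L))) *ᵥ ψ) ⬝ᵥ
      ((∑ u : Fin 2 → Fin R', P (a + fun i => ((u i : ℕ) : ZMod L))) *ᵥ ψ)).re with hF
  -- pointwise Cauchy–Schwarz over the `q²` sub-blocks
  have hpt : ∀ a : TorusSite 2 L,
      (star ((∑ u : Fin 2 → Fin (q * R'), P (a + fun i => ((u i : ℕ) : ZMod L))) *ᵥ ψ) ⬝ᵥ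
          ((∑ u : Fin 2 → Fin (q * R'), P (a + fun i => ((u i : ℕ) : ZMod L))) *ᵥ ψ)).re ≤
        (q : ℝ) ^ 2 * ∑ b : Fin 2 → Fin q, F (a + fun i => ((R' * (b i : ℕ) : ℕ) : ZMod L)) := by
    intro a
    rw [block_mul_eq_sum_block q R' P a, Matrix.sum_mulVec]
    have hCS := re_star_sum_dotProduct_sum_le (fun b : Fin 2 → Fin q =>
      (∑ u' : Fin 2 → Fin R',
        P ((a + fun i => ((R' * (b i : ℕ) : ℕ) : ZMod L)) + fun i => ((u' i : ℕ) : ZMod L))) *ᵥ ψ)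
    have hcard : (Fintype.card (Fin 2 → Fin q) : ℝ) = (q : ℝ) ^ 2 := by
      rw [Fintype.card_fun, Fintype.card_fin, Fintype.card_fin, Nat.cast_pow]
    rw [hcard] at hCS
    exact hCS
  -- sum over anchors and translate each sub-block sum back to the origin
  have htrans : ∀ b : Fin 2 → Fin q,
      ∑ a : TorusSite 2 L, F (a + fun i => ((R' * (b i : ℕ) : ℕ) : ZMod L)) = ∑ a : TorusSite 2 L, F a :=
    fun b => Fintype.sum_equiv (Equiv.addRight _) _ _ fun a => rfl
  calc ∑ a : TorusSite 2 L,
        (star ((∑ u : Fin 2 → Fin (q * R'), P (a + fun i => ((u i : ℕ) : ZMod L))) *ᵥ ψ) ⬝ᵥ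
          ((∑ u : Fin 2 → Fin (q * R'), P (a + fun i => ((u i : ℕ) : ZMod L))) *ᵥ ψ)).re
      ≤ ∑ a : TorusSite 2 L, (q : ℝ) ^ 2 *
          ∑ b : Fin 2 → Fin q, F (a + fun i => ((R' * (b i : ℕ) : ℕ) : ZMod L)) :=
        Finset.sum_le_sum fun a _ => hpt a
    _ = (q : ℝ) ^ 2 * ∑ b : Fin 2 → Fin q, ∑ a : TorusSite 2 L,
          F (a + fun i => ((R' * (b i : ℕ) : ℕ) : ZMod L)) := by
        rw [← Finset.mul_sum, Finset.sum_comm]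
    _ = (q : ℝ) ^ 2 * ∑ b : Fin 2 → Fin q, ∑ a : TorusSite 2 L, F a := by
        simp_rw [htrans]
    _ = (q : ℝ) ^ 4 * ∑ a : TorusSite 2 L, F a := by
        rw [Finset.sum_const, Finset.card_univ, Fintype.card_fun, Fintype.card_fin, Fintype.card_fin,
          nsmul_eq_mul, Nat.cast_pow]
        ring

omit [NeZero L] in
/-- `Re⟨X + Y, X + Y⟩ ≤ 2 Re⟨X, X⟩ + 2 Re⟨Y, Y⟩`. [folklore] -/
theorem re_star_add_dotProduct_add_le (X Y : n → ℂ) :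
    (star (X + Y) ⬝ᵥ (X + Y)).re ≤ 2 * (star X ⬝ᵥ X).re + 2 * (star Y ⬝ᵥ Y).re := by
  have h := re_star_sum_dotProduct_sum_le (fun i : Fin 2 => if i = 0 then X else Y)
  simp only [Fin.sum_univ_two, Fin.isValue, ↓reduceIte, one_ne_zero, Fintype.card_fin,
    Nat.cast_ofNat] at h
  linarith

/-- **Two arbitrary scales, block form.** For `qR' ≤ R`, any family of matrices `P_x` on
`(ℤ/Lℤ)²` and any vector `ψ`:
`Σ_a ‖B_R(a)ψ‖² ≤ 2q⁴ Σ_a ‖B_{R'}(a)ψ‖² + 2 (R² - q²R'²)² Σ_x ‖P_x ψ‖²` — split the offset box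
`[0,R)²` into the core `[0,qR')²` (handled by `sum_block_mul_le`) and the remainder frame of
`R² - q²R'²` offsets (Cauchy–Schwarz, then each offset contributes the full local weight
`Σ_x ‖P_x ψ‖²` after the anchor sum). [folklore] -/
theorem sum_block_le_of_mul_le (R R' q : ℕ) (hq : q * R' ≤ R) (P : TorusSite 2 L → Matrix n n ℂ)
    (ψ : n → ℂ) :
    ∑ a : TorusSite 2 L,
        (star ((∑ u : Fin 2 → Fin R, P (a + fun i => ((u i : ℕ) : ZMod L))) *ᵥ ψ) ⬝ᵥ
          ((∑ u : Fin 2 → Fin R, P (a + fun i => ((u i : ℕ) : ZMod L))) *ᵥ ψ)).re ≤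
      2 * (q : ℝ) ^ 4 * ∑ a : TorusSite 2 L,
        (star ((∑ u : Fin 2 → Fin R', P (a + fun i => ((u i : ℕ) : ZMod L))) *ᵥ ψ) ⬝ᵥ
          ((∑ u : Fin 2 → Fin R', P (a + fun i => ((u i : ℕ) : ZMod L))) *ᵥ ψ)).re +
      2 * ((R ^ 2 - (q * R') ^ 2 : ℕ) : ℝ) ^ 2 *
        ∑ x : TorusSite 2 L, (star (P x *ᵥ ψ) ⬝ᵥ (P x *ᵥ ψ)).re := by
  classical
  -- the core offsets, embedded
  set ι : (Fin 2 → Fin (q * R')) ↪ (Fin 2 → Fin R) :=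
    ⟨fun v i => Fin.castLE hq (v i), fun v w h => by
      funext i
      have := congr_fun h i
      exact Fin.castLE_injective hq this⟩ with hι
  set S : Finset (Fin 2 → Fin R) := Finset.univ.map ι with hS
  -- cardinality of the remainder frame
  have hcardS : Sᶜ.card = R ^ 2 - (q * R') ^ 2 := by
    simp only [Finset.card_compl, hS, Finset.card_map, Finset.card_univ, Fintype.card_fun,
      Fintype.card_fin]
  -- split of each block into core and remainder
  have hsplit : ∀ a : TorusSite 2 L,
      (∑ u : Fin 2 → Fin R, P (a + fun i => ((u i : ℕ) : ZMod L))) *ᵥ ψ =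
        (∑ u : Fin 2 → Fin (q * R'), P (a + fun i => ((u i : ℕ) : ZMod L))) *ᵥ ψ +
          (∑ u ∈ Sᶜ, P (a + fun i => ((u i : ℕ) : ZMod L))) *ᵥ ψ := by
    intro a
    rw [← Matrix.add_mulVec,
      ← Finset.sum_add_sum_compl S (fun u : Fin 2 → Fin R => P (a + fun i => ((u i : ℕ) : ZMod L)))]
    congr 2
    rw [hS, Finset.sum_map]
    refine Finset.sum_congr rfl fun v _ => ?_
    simp [hι]
  -- the remainder term, per anchor: Cauchy–Schwarz over `Sᶜ`
  have hYle : ∀ a : TorusSite 2 L,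
      (star ((∑ u ∈ Sᶜ, P (a + fun i => ((u i : ℕ) : ZMod L))) *ᵥ ψ) ⬝ᵥ
          ((∑ u ∈ Sᶜ, P (a + fun i => ((u i : ℕ) : ZMod L))) *ᵥ ψ)).re ≤
        (Sᶜ.card : ℝ) * ∑ u ∈ Sᶜ, (star (P (a + fun i => ((u i : ℕ) : ZMod L)) *ᵥ ψ) ⬝ᵥ
          (P (a + fun i => ((u i : ℕ) : ZMod L)) *ᵥ ψ)).re := by
    intro a
    have hCS := re_star_sum_dotProduct_sum_le
      (fun u : (Sᶜ : Finset (Fin 2 → Fin R)) => P (a + fun i => (((u : Fin 2 → Fin R) i : ℕ) : ZMod L)) *ᵥ ψ)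
    rw [Fintype.card_coe, Finset.sum_coe_sort Sᶜ (fun u => (star (P (a + fun i => ((u i : ℕ) : ZMod L)) *ᵥ ψ) ⬝ᵥ
        (P (a + fun i => ((u i : ℕ) : ZMod L)) *ᵥ ψ)).re),
      Finset.sum_coe_sort Sᶜ (fun u => P (a + fun i => ((u i : ℕ) : ZMod L)) *ᵥ ψ)] at hCS
    rw [Matrix.sum_mulVec]
    exact hCS
  -- the core term, summed over anchors
  have hXsum := sum_block_mul_le (L := L) q R' P ψ
  -- the remainder term, summed over anchors: swap and translate
  have hYsum : ∑ a : TorusSite 2 L, ∑ u ∈ Sᶜ, (star (P (a + fun i => ((u i : ℕ) : ZMod L)) *ᵥ ψ) ⬝ᵥ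
        (P (a + fun i => ((u i : ℕ) : ZMod L)) *ᵥ ψ)).re =
      (Sᶜ.card : ℝ) * ∑ x : TorusSite 2 L, (star (P x *ᵥ ψ) ⬝ᵥ (P x *ᵥ ψ)).re := by
    rw [Finset.sum_comm]
    have h : ∀ u : Fin 2 → Fin R, ∑ a : TorusSite 2 L,
        (star (P (a + fun i => ((u i : ℕ) : ZMod L)) *ᵥ ψ) ⬝ᵥ (P (a + fun i => ((u i : ℕ) : ZMod L)) *ᵥ ψ)).re =
          ∑ x : TorusSite 2 L, (star (P x *ᵥ ψ) ⬝ᵥ (P x *ᵥ ψ)).re :=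
      fun u => Fintype.sum_equiv (Equiv.addRight _) _ _ fun a => rfl
    simp_rw [h]
    rw [Finset.sum_const, nsmul_eq_mul]
  -- pointwise bound per anchor
  have hpt : ∀ a : TorusSite 2 L,
      (star ((∑ u : Fin 2 → Fin R, P (a + fun i => ((u i : ℕ) : ZMod L))) *ᵥ ψ) ⬝ᵥ
          ((∑ u : Fin 2 → Fin R, P (a + fun i => ((u i : ℕ) : ZMod L))) *ᵥ ψ)).re ≤
        2 * (star ((∑ u : Fin 2 → Fin (q * R'), P (a + fun i => ((u i : ℕ) : ZMod L))) *ᵥ ψ) ⬝ᵥ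
          ((∑ u : Fin 2 → Fin (q * R'), P (a + fun i => ((u i : ℕ) : ZMod L))) *ᵥ ψ)).re +
        2 * ((Sᶜ.card : ℝ) * ∑ u ∈ Sᶜ, (star (P (a + fun i => ((u i : ℕ) : ZMod L)) *ᵥ ψ) ⬝ᵥ
          (P (a + fun i => ((u i : ℕ) : ZMod L)) *ᵥ ψ)).re) := by
    intro a
    rw [hsplit a]
    have h := re_star_add_dotProduct_add_le
      ((∑ u : Fin 2 → Fin (q * R'), P (a + fun i => ((u i : ℕ) : ZMod L))) *ᵥ ψ)
      ((∑ u ∈ Sᶜ, P (a + fun i => ((u i : ℕ) : ZMod L))) *ᵥ ψ)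
    linarith [hYle a]
  -- assemble
  calc ∑ a : TorusSite 2 L,
        (star ((∑ u : Fin 2 → Fin R, P (a + fun i => ((u i : ℕ) : ZMod L))) *ᵥ ψ) ⬝ᵥ
          ((∑ u : Fin 2 → Fin R, P (a + fun i => ((u i : ℕ) : ZMod L))) *ᵥ ψ)).re
      ≤ ∑ a : TorusSite 2 L,
          (2 * (star ((∑ u : Fin 2 → Fin (q * R'), P (a + fun i => ((u i : ℕ) : ZMod L))) *ᵥ ψ) ⬝ᵥ
            ((∑ u : Fin 2 → Fin (q * R'), P (a + fun i => ((u i : ℕ) : ZMod L))) *ᵥ ψ)).re +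
          2 * ((Sᶜ.card : ℝ) * ∑ u ∈ Sᶜ, (star (P (a + fun i => ((u i : ℕ) : ZMod L)) *ᵥ ψ) ⬝ᵥ
            (P (a + fun i => ((u i : ℕ) : ZMod L)) *ᵥ ψ)).re)) :=
        Finset.sum_le_sum fun a _ => hpt a
    _ = 2 * ∑ a : TorusSite 2 L,
          (star ((∑ u : Fin 2 → Fin (q * R'), P (a + fun i => ((u i : ℕ) : ZMod L))) *ᵥ ψ) ⬝ᵥ
            ((∑ u : Fin 2 → Fin (q * R'), P (a + fun i => ((u i : ℕ) : ZMod L))) *ᵥ ψ)).re +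
        2 * (Sᶜ.card : ℝ) * ∑ a : TorusSite 2 L, ∑ u ∈ Sᶜ,
          (star (P (a + fun i => ((u i : ℕ) : ZMod L)) *ᵥ ψ) ⬝ᵥ
            (P (a + fun i => ((u i : ℕ) : ZMod L)) *ᵥ ψ)).re := by
        rw [Finset.sum_add_distrib, ← Finset.mul_sum, ← Finset.mul_sum, ← Finset.mul_sum, mul_assoc]
    _ ≤ 2 * ((q : ℝ) ^ 4 * ∑ a : TorusSite 2 L,
          (star ((∑ u : Fin 2 → Fin R', P (a + fun i => ((u i : ℕ) : ZMod L))) *ᵥ ψ) ⬝ᵥ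
            ((∑ u : Fin 2 → Fin R', P (a + fun i => ((u i : ℕ) : ZMod L))) *ᵥ ψ)).re) +
        2 * (Sᶜ.card : ℝ) * ((Sᶜ.card : ℝ) * ∑ x : TorusSite 2 L, (star (P x *ᵥ ψ) ⬝ᵥ (P x *ᵥ ψ)).re) := by
        rw [hYsum]
        linarith [hXsum]
    _ = _ := by
        rw [hcardS]
        ring

end Blocks

/-! ### Registered form -/

/-- **Registered form of the two-scale block bound** (sub-goal `blockTwoScaleBound` of crux
stmt-HubbardSuperconductivity-7331; `sum_block_le_of_mul_le` with its section variables bound):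
for `qR' ≤ R`, `Σ_a ‖B_R(a)ψ‖² ≤ 2q⁴ Σ_a ‖B_{R'}(a)ψ‖² + 2 (R² - q²R'²)² Σ_x ‖P_x ψ‖²`. [folklore] -/
theorem blockTwoScaleBound : ∀ {n : Type} [Fintype n] {L : ℕ} [NeZero L] (R R' q : ℕ), q * R' ≤ R → ∀ (P : TorusSite 2 L → Matrix n n ℂ) (ψ : n → ℂ), ∑ a : TorusSite 2 L, (star ((∑ u : Fin 2 → Fin R, P (a + fun i => ((u i : ℕ) : ZMod L))) *ᵥ ψ) ⬝ᵥ ((∑ u : Fin 2 → Fin R, P (a + fun i => ((u i : ℕ) : ZMod L))) *ᵥ ψ)).re ≤ 2 * (q : ℝ) ^ 4 * ∑ a : TorusSite 2 L, (star ((∑ u : Fin 2 → Fin R', P (a + fun i => ((u i : ℕ) : ZMod L))) *ᵥ ψ) ⬝ᵥ ((∑ u : Fin 2 → Fin R', P (a + fun i => ((u i : ℕ) : ZMod L))) *ᵥ ψ)).re + 2 * ((R ^ 2 - (q * R') ^ 2 : ℕ) : ℝ) ^ 2 * ∑ x : TorusSite 2 L, (star (P x *ᵥ ψ) ⬝ᵥ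 (P x *ᵥ ψ)).re :=
  fun R R' q hq P ψ => sum_block_le_of_mul_le R R' q hq P ψ

end Summit.HubbardSuperconductivity.HubbardSuperconductivity.Theorems.FunctionFieldCertificate
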